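import Summits.ValiantsHypothesis.ValiantsHypothesis.Theorems.FifoMatchingNNDivisionHardExactIsVirtual
import Literature.Barriers.PneNP.ExtendedFormulationMinkowskiFaces
import HarnessLib

/-!
# PENCIL COLLAPSE — an exact row family with ONE infinitesimal singleton pencil is COR-VIRTUAL
# (crux `NNDivisionHard`, stmt-ValiantsHypothesis-21181; route `FifoMatching`; line `virtual_passenger`; val-idea-41 g5, W7)

Crux workfile (kernel food; elaborates against the TREE: `Theorems/FifoMatchingNNDivisionHardRowFamilies.lean` (the `RowFamily` /
`RowFamily.Law` frame, `T`, `CorVirtualHardN`, `exactTilted`, `ExactPencilLaw`), `Theorems/FifoMatchingNNDivisionHardExactIsVirtual.lean`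
(✓ p688316, val-idea-41 g4: `hCORv`, `law_of_corVirtualHardN` for SHARP families, `exactPencilLaw_iff_corVirtualHardN`) and the Literature EF
calculus `ExtendedFormulationYannakakisConverse` (✓ p687464) / `ExtendedFormulationMinkowskiFaces` / `ExtendedFormulationLinearImage`).

QUESTION LEFT OPEN BY g4 (memo `ExactIsVirtual41.md` §3; critic val-idea-crit-9 g3, CRITIC-wave7 row 140 «L♯(B) candidate untyped (Sharp test
first)»): g4 proved that every SHARP row family (one containing, for every direction `w` and `δ > 0`, a positive multiple of `w` with `δ`-exact
rhs — e.g. the pure-tilt rows `a = ∅` of `exactTilted`) has `F.Law ↔ CorVirtualHardN`, and proposed as the next PROPER intermediate law the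
bounded-tilt exact family **L♯(B)**: rows `(a, W)` with `a ≠ ∅`, `‖W‖∞ ≤ B`, `ρ = udRow a + flat W`, TRULY exact rhs `β = h_COR(ρ)`.  L♯(B) is
NOT sharp (no pure tilts, tilt-to-clique ratio ≤ B).

ANSWER (this file): **L♯(B) collapses too — `(boundedExact B).Law ↔ CorVirtualHardN` for EVERY `B = B(n) > 0`** (`boundedExactLaw_iff`), and so
does the law of the TREE family `exactTilted` restricted to ONE singleton clique with `B`-bounded tilts and its rhs `1 + h_COR(W)`
(`singletonTiltedLaw_iff`; hence `exactPencilLaw_iff_singletonTiltedLaw`: C′ needs neither `a = ∅` nor unbounded tilts to be COR-VIRTUAL).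
The general statement is the

**PENCIL COLLAPSE THEOREM** `law_of_corVirtualHardN_of_pencil`: if a valid row family `F` has, at every large order `k + 1`, an INFINITESIMAL
EXACT PENCIL at the singleton clique `{0}` (`Pencil F (k+1) 0`: for every matrix direction `W` some `ε₀ > 0` such that for all `0 < ε ≤ ε₀` a
positive multiple of the row `udRow {0} + ε • flat W` lies in `F` with exact rhs `β ≤ t · h_COR`), then `CorVirtualHardN → F.Law`
(the converse `F.Law → CorVirtualHardN` is Yannakakis forward, the tree's `corVirtualHardN_of_law`, for every valid family).

MECHANISM (face-local completeness).  Let `G₀ = {x ∈ COR(k+1) : x₀₀ = 1} = conv{x_b : 0 ∈ b}` (an affine copy of `COR(k)`: block coordinates)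
and, for a passenger list `q`, `M₀ = max_j (q_j)₀₀`, `F_Q = conv{q_j : (q_j)₀₀ = M₀}` (the top face of `Q` in direction `E₀₀`).  To first order in
`ε` the pencil row `({0}, εW)` reads EXACTLY the slack of the direction `W` over the face pair `G₀ + F_Q`:
`h_COR(E₀₀ + εW) = 1 + ε · max_{b ∋ 0} ⟨W, x_b⟩` once `ε‖W‖₁ < 1/2` (`hCORv_pencil_le`) and `max_j ⟨E₀₀ + εW, q_j⟩ = M₀ + ε · max_{j top} ⟨W, q_j⟩`
once `ε` is below the vertex gap of `q` in direction `E₀₀` (`passenger_pencil_le`, `exists_small_eps`).  Hence (Hahn–Banach) the pencil rows are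
COMPLETE for `G₀ + F_Q` RELATIVE to the hyperplane `x₀₀ = 1 + M₀` (`pencil_complete`); Yannakakis' converse for a complete family
(`hasEFOfSize_of_complete_nonneg_factorization`, the hyperplane appended as two zero-slack rows) turns an `F`-blind nonnegative factorisation of
the located slack of `COR(k+1) + Q` through slots `σ` into `HasEFOfSize (G₀ + F_Q) |σ|` (`hasEFOfSize_face`); the block projection `π`
(`HasEFOfSize.image_linearMap`, `π(x_{lift b'}) = x_{b'}`) gives `HasEFOfSize (COR(k) + π F_Q) |σ|` (`π_image_face`) while `π F_Q`, a projected
face of `Q`, keeps `Q`'s budget (`hasEFOfSize_topFace`, via `convexHull_inter_dotProduct_eq_of_valid` + `inter_eq` + `image_linearMap`); and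
COR-VIRTUAL at `(c+1, k)` with `T c (k+1) < T (c+1) k` (`T_succ_lt_T_succ`) yields the law's `T c (k+1) < r`.

CONSEQUENCES (memo `PencilCollapse41.md`): (1) g4's design rule «a proper intermediate law must not be sharp» is INSUFFICIENT — the rule of record
becomes «no complete infinitesimal pencil at any singleton clique, at any scale»: proper intermediate located laws have FINITE / DISCRETE tilt
alphabets per order (exact rhs), and such a law is exactly as strong as its alphabet read on the face pair `COR(k) + F_Q`, recursively;
(2) the law-level pencil is the row-side twin of val-idea-43 g6's passenger-side free-face functor `Localization.Face` (✓ p687398 / p688217):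
ONE localisation, seen from the two sides of the slack matrix.

HONEST LABEL: REFORMULATION / law-design result; closes NO route item; `(boundedExact B).Law`, `(singletonTilted B).Law`, `ExactPencilLaw`,
`CorVirtualHardN`, `NNDivisionHard` (21181) all remain OPEN and are here only proved EQUIVALENT; VP ≠ VNP is NOT proved here or anywhere in this tree.

PORT (val-port-3 g3, b71 (B) port pool; desk ruling #444): verbatim `Theorems/` port of the crux workfile
`Cruxes/NNDivisionHard/PencilCollapse41.lean` @74b940273780 (sha16 19dd3ecc7ffcf7b3, 714 l.; author val-idea-41 g5; critic of record
val-idea-crit-9 g3, V#120a/V#121a KERNEL OF RECORD), SPLIT at the 400-line cap into two chained modules: THIS file = §0–§3 (helpers, `Pencil`,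
the face `x₀₀ = 1` and the first-order reading of a pencil row, relative completeness `pencil_complete`); `FifoMatchingNNDivisionHardPencilCollapse.lean`
= §4–§7 (Yannakakis' converse on the face pair, block projection, ★ `law_of_corVirtualHardN_of_pencil`, the instances `boundedExactLaw_iff` /
`singletonTiltedLaw_iff` / `exactPencilLaw_iff_singletonTiltedLaw`).  Namespace moved from `…Cruxes.NNDivisionHard.PencilCollapse41` to
`…Theorems.FifoMatching.PencilCollapse`; one-line docstrings added where the gate's `lint.docstring` requires them; `linter.unusedVariables false`
dropped (unused binders `_`-prefixed instead, statements unchanged); the three §0 restatements `flat_add₅` / `flat_smul₅` / `exists_fin_range_eq₅`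
DELETED per the gate's `dedup.landed` (part 2 uses the landed `LocatedRows.flat_add'` / `LocatedRows.flat_smul'` / `LowDim.exists_fin_range_eq`
instead); nothing else edited.  `--supports stmt-ValiantsHypothesis-21181` helper.
ALL CREDIT: val-idea-41 g5.
-/

set_option autoImplicit false
-- the mandated summit-side namespace repeats a component by design (single-problem summit)
set_option linter.dupNamespace false

noncomputable section

open Matrix Finset
open scoped Pointwise

namespace Summit.ValiantsHypothesis.ValiantsHypothesis.Theorems.FifoMatching.PencilCollapse

open Literature.Barriers.PneNP (HasEFOfSize hasEFOfSize_of_complete_nonneg_factorization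
  convexHull_inter_dotProduct_eq_of_valid)
open Literature.Combinatorics.Optimization.FixedSizePsdRank (Cube bvec flat vecOuter corPolytope bvec_zero_or_one)
open Summit.ValiantsHypothesis.ValiantsHypothesis.Theorems.FifoMatching.XcDivision (udInd udPt udRow udMat ud_data)
open Summit.ValiantsHypothesis.ValiantsHypothesis.Theorems.FifoMatching.LocatedRows
  (T CorVirtualHardN RowFamily exactTilted ExactPencilLaw hCOR le_hCOR exists_eq_hCOR flat_le_hCOR unflat flat_unflat
    corVirtualHardN_of_law corVirtualHardN_of_exactPencilLaw)
open Summit.ValiantsHypothesis.ValiantsHypothesis.Theorems.FifoMatching.ExactIsVirtual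
  (hCORv le_hCORv exists_eq_hCORv le_hCORv_of_mem hCOR_eq_hCORv hCORv_smul_le vecOuter_bvec_eq_udPt
    law_of_corVirtualHardN exactTilted_sharp exactPencilLaw_iff_corVirtualHardN)

/-! ## §0 Small helpers -/

section Helpers
variable {n : ℕ}

/-- the singleton clique row is the matrix unit: `udRow {l} = flat (udMat {l})` and `⟨E_ll, x_b⟩ = [l ∈ b]`. -/
theorem udRow_singleton_dotProduct_udPt (l : Fin n) (b : Finset (Fin n)) :
    udRow {l} ⬝ᵥ udPt b = if l ∈ b then 1 else 0 := by
  have h := (ud_data n).2.2.1 {l} b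
  by_cases hl : l ∈ b
  · rw [Finset.singleton_inter_of_mem hl, Finset.card_singleton] at h
    rw [if_pos hl]
    norm_num at h
    linarith
  · rw [Finset.singleton_inter_of_notMem hl, Finset.card_empty] at h
    rw [if_neg hl]
    norm_num at h
    linarith

/-- entries of a clique vertex are `0` or `1`. -/
theorem udPt_apply_zero_or_one (b : Finset (Fin n)) (p : Fin (n * n)) : udPt b p = 0 ∨ udPt b p = 1 := by
  unfold udPt vecOuter udInd
  rcases bvec_zero_or_one (fun i => decide (i ∈ b)) (finProdFinEquiv.symm p).1 with h | h <;>
    rcases bvec_zero_or_one (fun i => decide (i ∈ b)) (finProdFinEquiv.symm p).2 with h' | h' <;>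
      · rw [h, h']; norm_num

/-- the `ℓ¹` norm of a direction. -/
def l1 (w : Fin n → ℝ) : ℝ := ∑ p, |w p|

/-- `l1 w ≥ 0`. -/
theorem l1_nonneg (w : Fin n → ℝ) : 0 ≤ l1 w := Finset.sum_nonneg fun _ _ => abs_nonneg _

/-- `|⟨w, x_b⟩| ≤ ‖w‖₁`. -/
theorem abs_dotProduct_udPt_le {m : ℕ} (w : Fin (m * m) → ℝ) (b : Finset (Fin m)) : |w ⬝ᵥ udPt b| ≤ l1 w := by
  unfold dotProduct l1
  refine (Finset.abs_sum_le_sum_abs _ _).trans (Finset.sum_le_sum fun p _ => ?_)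
  rw [abs_mul]
  rcases udPt_apply_zero_or_one b p with h | h <;> simp [h]

/-- A SMALL PARAMETER below finitely many thresholds: given `ε₀ > 0`, `L`, `Dv`, and finitely many values `θv i ≤ M`, some
`0 < ε ≤ ε₀` has `ε L < 1/2` and `θv i + ε Dv < M - ε Dv` for every NON-top index (`θv i ≠ M`). -/
theorem exists_small_eps {ε₀ L Dv M : ℝ} (hε₀ : 0 < ε₀) {ι : Type} [Finite ι] (θv : ι → ℝ) (hθ : ∀ i, θv i ≤ M) :
    ∃ ε : ℝ, 0 < ε ∧ ε ≤ ε₀ ∧ ε * L < 1 / 2 ∧ ∀ i, θv i ≠ M → θv i + ε * Dv < M - ε * Dv := by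
  have key : ∀ᶠ ε in nhds (0 : ℝ), ε * L < 1 / 2 ∧ ∀ i, θv i ≠ M → θv i + ε * Dv < M - ε * Dv := by
    refine Filter.Eventually.and ?_ ?_
    · have hc : ContinuousAt (fun ε : ℝ => ε * L) 0 := by fun_prop
      have hc' : ContinuousAt (fun _ : ℝ => (1 : ℝ) / 2) 0 := continuousAt_const
      exact hc.eventually_lt hc' (by norm_num)
    · refine Filter.eventually_all.2 fun i => ?_
      by_cases hi : θv i = M
      · exact Filter.Eventually.of_forall fun ε h => absurd hi h
      · have hlt : θv i < M := lt_of_le_of_ne (hθ i) hi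
        have hc1 : ContinuousAt (fun ε : ℝ => θv i + ε * Dv) 0 := by fun_prop
        have hc2 : ContinuousAt (fun ε : ℝ => M - ε * Dv) 0 := by fun_prop
        have h := hc1.eventually_lt hc2 (by simpa using hlt)
        exact h.mono fun ε h _ => h
  obtain ⟨δ, hδ, hball⟩ := Metric.eventually_nhds_iff.1 key
  have hpos : 0 < min (δ / 2) ε₀ := lt_min (by linarith) hε₀
  refine ⟨min (δ / 2) ε₀, hpos, min_le_right _ _, ?_⟩
  have hmem : dist (min (δ / 2) ε₀) 0 < δ := by
    rw [Real.dist_eq, sub_zero, abs_of_pos hpos]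
    exact lt_of_le_of_lt (min_le_left _ _) (by linarith)
  exact hball hmem

end Helpers

/-! ## §1 The infinitesimal exact pencil -/

/-- **`Pencil F n l`** — the row family `F` contains, at order `n`, an INFINITESIMAL EXACT PENCIL at the singleton clique `l`: for every
matrix direction `W` and every `δ > 0` some row of `F` is a positive multiple `t • (udRow {l} + ε • flat W)` of the tilted singleton row at
some scale `0 < ε ≤ δ` (scales ACCUMULATING at `0`, direction by direction — no uniformity in `W` is asked), with EXACT right-hand side
(`β ≤ t · h_COR(udRow {l} + ε • flat W)`; `≥` is validity).  Every sharp family has it around each singleton; so does L♯(B)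
(`boundedExact_pencil`) and the singleton sub-pencil of `exactTilted` (`singletonTilted_pencil`).  A family with finitely many tilt
SCALES per order and direction (a finite / discrete exact alphabet) does not. -/
def Pencil (F : RowFamily) (n : ℕ) (l : Fin n) : Prop :=
  ∀ W : Matrix (Fin n) (Fin n) ℝ, ∀ δ : ℝ, 0 < δ → ∃ ε : ℝ, 0 < ε ∧ ε ≤ δ ∧
    ∃ a : F.A n, ∃ t : ℝ, 0 < t ∧ F.ρ n a = t • (udRow {l} + ε • flat W) ∧
      F.β n a ≤ t * hCORv (udRow {l} + ε • flat W)

/-! ## §2 The face `x₀₀ = 1` of `COR(k+1)` and the first-order (face-local) reading of a pencil row -/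

section Face
variable {k : ℕ}

/-- lift `b' ⊆ [k]` to the vertex index `{0} ∪ succ(b')` of the face `x₀₀ = 1`. -/
def lift (b' : Finset (Fin k)) : Finset (Fin (k + 1)) := insert 0 (b'.map (Fin.succEmb k))

/-- `0 ∈ lift b'`. -/
theorem zero_mem_lift (b' : Finset (Fin k)) : (0 : Fin (k + 1)) ∈ lift b' := Finset.mem_insert_self _ _

/-- `i.succ ∈ lift b' ↔ i ∈ b'`. -/
theorem succ_mem_lift {b' : Finset (Fin k)} {i : Fin k} : i.succ ∈ lift b' ↔ i ∈ b' := by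
  rw [lift, Finset.mem_insert]
  constructor
  · rintro (h | h)
    · exact absurd h (Fin.succ_ne_zero i)
    · obtain ⟨a, ha, hai⟩ := Finset.mem_map.1 h
      have : a = i := Fin.succ_injective _ (by simpa using hai)
      exact this ▸ ha
  · intro h
    exact Or.inr (Finset.mem_map.2 ⟨i, h, by simp⟩)

/-- the block part of a vertex index. -/
def down (b : Finset (Fin (k + 1))) : Finset (Fin k) := Finset.univ.filter fun i => i.succ ∈ b

/-- a vertex index containing `0` is the lift of its block part. -/
theorem lift_down {b : Finset (Fin (k + 1))} (h0 : (0 : Fin (k + 1)) ∈ b) : lift (down b) = b := by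
  ext i
  refine Fin.cases ?_ (fun i' => ?_) i
  · exact iff_of_true (zero_mem_lift _) h0
  · rw [succ_mem_lift]
    simp [down]

/-- the face maximum `max_{b ∋ 0} ⟨w, x_b⟩`, indexed through `lift`. -/
def ΦC (w : Fin ((k + 1) * (k + 1)) → ℝ) : ℝ :=
  Finset.univ.sup' Finset.univ_nonempty (fun b' : Finset (Fin k) => w ⬝ᵥ udPt (lift b'))

/-- ★ FIRST-ORDER READING, COR SIDE: `h_COR(E₀₀ + ε w) ≤ 1 + ε · max_{b ∋ 0} ⟨w, x_b⟩` once `ε ‖w‖₁ < 1/2` (the maximum localises to the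
face `x₀₀ = 1`; equality in fact). -/
theorem hCORv_pencil_le (w : Fin ((k + 1) * (k + 1)) → ℝ) {ε : ℝ} (hε : 0 < ε) (hεw : ε * l1 w < 1 / 2) :
    hCORv (udRow {0} + ε • w) ≤ 1 + ε * ΦC w := by
  refine Finset.sup'_le _ _ fun b _ => ?_
  rw [add_dotProduct, smul_dotProduct, smul_eq_mul, udRow_singleton_dotProduct_udPt]
  have hwb : |w ⬝ᵥ udPt b| ≤ l1 w := abs_dotProduct_udPt_le w b
  have h1 : w ⬝ᵥ udPt (lift (down b)) ≤ ΦC w :=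
    Finset.le_sup' (fun b' : Finset (Fin k) => w ⬝ᵥ udPt (lift b')) (Finset.mem_univ (down b))
  by_cases h0 : (0 : Fin (k + 1)) ∈ b
  · rw [if_pos h0]
    rw [lift_down h0] at h1
    have h2 := mul_le_mul_of_nonneg_left h1 hε.le
    linarith
  · rw [if_neg h0]
    have h2 : |w ⬝ᵥ udPt (lift (down b))| ≤ l1 w := abs_dotProduct_udPt_le w _
    have ha := (abs_le.1 hwb).2
    have hb := (abs_le.1 h2).1
    have e1 := mul_le_mul_of_nonneg_left ha hε.le
    have e2 := mul_le_mul_of_nonneg_left hb hε.le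
    have e3 := mul_le_mul_of_nonneg_left h1 hε.le
    have e4 : ε * -l1 w = -(ε * l1 w) := by ring
    linarith

variable {K : ℕ}

/-- the `(0,0)` entries of the passenger generators, `θ_j = ⟨E₀₀, q_j⟩`. -/
def θ (q : Fin (K + 1) → (Fin ((k + 1) * (k + 1)) → ℝ)) (j : Fin (K + 1)) : ℝ := udRow {0} ⬝ᵥ q j

/-- their maximum `M₀`. -/
def M₀ (q : Fin (K + 1) → (Fin ((k + 1) * (k + 1)) → ℝ)) : ℝ := Finset.univ.sup' Finset.univ_nonempty (θ q)

/-- the TOP index set of the passenger in direction `E₀₀`. -/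
def top (q : Fin (K + 1) → (Fin ((k + 1) * (k + 1)) → ℝ)) : Finset (Fin (K + 1)) :=
  Finset.univ.filter fun j => θ q j = M₀ q

/-- each `θ_j` is at most the top value `M₀`. -/
theorem θ_le_M₀ (q : Fin (K + 1) → (Fin ((k + 1) * (k + 1)) → ℝ)) (j : Fin (K + 1)) : θ q j ≤ M₀ q :=
  Finset.le_sup' (θ q) (Finset.mem_univ j)

/-- the top face index set is nonempty. -/
theorem top_nonempty (q : Fin (K + 1) → (Fin ((k + 1) * (k + 1)) → ℝ)) : (top q).Nonempty := by
  obtain ⟨j, -, hj⟩ := Finset.exists_mem_eq_sup' Finset.univ_nonempty (θ q)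
  refine ⟨j, Finset.mem_filter.2 ⟨Finset.mem_univ _, ?_⟩⟩
  unfold M₀
  exact hj.symm

/-- membership in `top q`: `θ_j = M₀`. -/
theorem mem_top {q : Fin (K + 1) → (Fin ((k + 1) * (k + 1)) → ℝ)} {j : Fin (K + 1)} : j ∈ top q ↔ θ q j = M₀ q := by
  simp [top]

/-- the face maximum `max_{j top} ⟨w, q_j⟩` of the passenger. -/
def ΦQ (q : Fin (K + 1) → (Fin ((k + 1) * (k + 1)) → ℝ)) (w : Fin ((k + 1) * (k + 1)) → ℝ) : ℝ :=
  (top q).sup' (top_nonempty q) fun j => w ⬝ᵥ q j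

/-- a bound `D ≥ |⟨w, q_j⟩|` for all `j`. -/
def D (q : Fin (K + 1) → (Fin ((k + 1) * (k + 1)) → ℝ)) (w : Fin ((k + 1) * (k + 1)) → ℝ) : ℝ :=
  Finset.univ.sup' Finset.univ_nonempty fun j : Fin (K + 1) => |w ⬝ᵥ q j|

/-- the vertex gap `D q w` is nonnegative. -/
theorem D_nonneg (q : Fin (K + 1) → (Fin ((k + 1) * (k + 1)) → ℝ)) (w : Fin ((k + 1) * (k + 1)) → ℝ) : 0 ≤ D q w :=
  (abs_nonneg (w ⬝ᵥ q 0)).trans (Finset.le_sup' (fun j => |w ⬝ᵥ q j|) (Finset.mem_univ 0))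

/-- ★ FIRST-ORDER READING, PASSENGER SIDE: below the vertex gap, `⟨E₀₀ + ε w, q_j⟩ ≤ M₀ + ε · max_{j top} ⟨w, q_j⟩` for every `j`. -/
theorem passenger_pencil_le (q : Fin (K + 1) → (Fin ((k + 1) * (k + 1)) → ℝ)) (w : Fin ((k + 1) * (k + 1)) → ℝ)
    {ε : ℝ} (hε : 0 < ε) (hgap : ∀ j, θ q j ≠ M₀ q → θ q j + ε * D q w < M₀ q - ε * D q w) (j : Fin (K + 1)) :
    (udRow {0} + ε • w) ⬝ᵥ q j ≤ M₀ q + ε * ΦQ q w := by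
  rw [add_dotProduct, smul_dotProduct, smul_eq_mul]
  change θ q j + ε * (w ⬝ᵥ q j) ≤ _
  obtain ⟨j₀, hj₀⟩ := top_nonempty q
  have hj₀' : w ⬝ᵥ q j₀ ≤ ΦQ q w := Finset.le_sup' (fun j => w ⬝ᵥ q j) hj₀
  have hD0 : |w ⬝ᵥ q j₀| ≤ D q w := Finset.le_sup' (fun j => |w ⬝ᵥ q j|) (Finset.mem_univ j₀)
  have hDj : |w ⬝ᵥ q j| ≤ D q w := Finset.le_sup' (fun j => |w ⬝ᵥ q j|) (Finset.mem_univ j)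
  by_cases hj : θ q j = M₀ q
  · have hjt : w ⬝ᵥ q j ≤ ΦQ q w := Finset.le_sup' (fun j => w ⬝ᵥ q j) (mem_top.2 hj)
    rw [hj]
    have := mul_le_mul_of_nonneg_left hjt hε.le
    linarith
  · have h := hgap j hj
    have h1 := (abs_le.1 hDj).2
    have h2 := (abs_le.1 hD0).1
    have e1 := mul_le_mul_of_nonneg_left h1 hε.le
    have e2 := mul_le_mul_of_nonneg_left h2 hε.le
    have e3 := mul_le_mul_of_nonneg_left hj₀' hε.le
    have e4 : ε * -D q w = -(ε * D q w) := by ring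
    linarith

/-! ## §3 Relative completeness of the pencil for the face pair (Hahn–Banach) -/

/-- the LOCATED COLUMNS of the face pair: `(b', j) ↦ x_{lift b'} + q_j`, `j` a top index; their hull is
`G₀ + F_Q = conv{x_b : 0 ∈ b} + conv{q_j : j top}`. -/
def faceVert (q : Fin (K + 1) → (Fin ((k + 1) * (k + 1)) → ℝ)) :
    Finset (Fin k) × (top q) → (Fin ((k + 1) * (k + 1)) → ℝ) :=
  fun p => udPt (lift p.1) + q (p.2 : Fin (K + 1))

/-- ★★ **RELATIVE COMPLETENESS OF THE PENCIL.**  A point ON the hyperplane `x₀₀ = 1 + M₀` that satisfies every row inequality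
`ρ_a · x ≤ β_a + m_a` of a family with an infinitesimal exact pencil at `{0}` (passenger maxima `m_a` attained) lies in the face pair
`conv{x_{lift b'} + q_j}`.  (Separate a bad point by `w`; the pencil row `({0}, εw)` for small `ε` reads `w` on the face pair and is violated.) -/
theorem pencil_complete (F : RowFamily) (hP : Pencil F (k + 1) 0) (q : Fin (K + 1) → (Fin ((k + 1) * (k + 1)) → ℝ))
    (m : F.A (k + 1) → ℝ) (hmax : ∀ a, ∃ j, F.ρ (k + 1) a ⬝ᵥ q j = m a)
    (x : Fin ((k + 1) * (k + 1)) → ℝ) (hx : udRow {0} ⬝ᵥ x = 1 + M₀ q)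
    (hrow : ∀ a : F.A (k + 1), F.ρ (k + 1) a ⬝ᵥ x ≤ F.β (k + 1) a + m a) :
    x ∈ convexHull ℝ (Set.range (faceVert q)) := by
  classical
  by_contra hxP
  have hcl : IsClosed (convexHull ℝ (Set.range (faceVert q))) :=
    (Set.Finite.isCompact_convexHull (𝕜 := ℝ) (Set.finite_range _)).isClosed
  obtain ⟨f, u, hfP, hux⟩ := geometric_hahn_banach_closed_point (convex_convexHull ℝ _) hcl hxP
  -- the functional as a vector
  let w : Fin ((k + 1) * (k + 1)) → ℝ := fun p => f (Pi.single p 1)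
  have hfw : ∀ z : Fin ((k + 1) * (k + 1)) → ℝ, f z = w ⬝ᵥ z := by
    intro z
    conv_lhs => rw [pi_eq_sum_univ' z]
    rw [map_sum]
    simp only [map_smul, smul_eq_mul, dotProduct, w]
    refine Finset.sum_congr rfl fun p _ => ?_
    ring
  -- the two maximisers on the face pair, and `ΦC + ΦQ < u < w · x`
  obtain ⟨b₀, -, hb₀⟩ :=
    Finset.exists_mem_eq_sup' Finset.univ_nonempty (fun b' : Finset (Fin k) => w ⬝ᵥ udPt (lift b'))
  obtain ⟨j₀, hj₀, hj₀'⟩ := Finset.exists_mem_eq_sup' (top_nonempty q) (fun j => w ⬝ᵥ q j)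
  have hlt : ΦC w + ΦQ q w < u := by
    have h := hfP (faceVert q (b₀, ⟨j₀, hj₀⟩)) (subset_convexHull ℝ _ ⟨(b₀, ⟨j₀, hj₀⟩), rfl⟩)
    rw [hfw] at h
    simp only [faceVert, dotProduct_add] at h
    unfold ΦC ΦQ
    rw [hb₀, hj₀']
    exact h
  have hux' : u < w ⬝ᵥ x := by rwa [hfw] at hux
  -- a pencil row below all thresholds (the thresholds are monotone in the scale)
  obtain ⟨δ, hδ, -, hδL, hδgap⟩ :=
    exists_small_eps (L := l1 w) (Dv := D q w) one_pos (θ q) (θ_le_M₀ q)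
  obtain ⟨ε, hε, hεδ, a, t, ht, hρ, hβ⟩ := hP (unflat w) δ hδ
  have hεL : ε * l1 w < 1 / 2 := lt_of_le_of_lt (mul_le_mul_of_nonneg_right hεδ (l1_nonneg w)) hδL
  have hgap : ∀ j, θ q j ≠ M₀ q → θ q j + ε * D q w < M₀ q - ε * D q w := fun j hj => by
    have h := hδgap j hj
    have e := mul_le_mul_of_nonneg_right hεδ (D_nonneg q w)
    linarith
  rw [flat_unflat] at hρ hβ
  have hC := hCORv_pencil_le w hε hεL
  obtain ⟨j₁, hj₁⟩ := hmax a
  have hQ := passenger_pencil_le q w hε hgap j₁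
  have h1 := hrow a
  rw [hρ, smul_dotProduct, smul_eq_mul] at h1 hj₁
  have hxval : (udRow {0} + ε • w) ⬝ᵥ x = 1 + M₀ q + ε * (w ⬝ᵥ x) := by
    rw [add_dotProduct, smul_dotProduct, smul_eq_mul, hx]
  rw [hxval] at h1
  have p1 := mul_le_mul_of_nonneg_left hC ht.le
  have p2 := mul_le_mul_of_nonneg_left hQ ht.le
  -- `t (1 + M₀ + ε w·x) ≤ t (1 + ε ΦC) + t (M₀ + ε ΦQ)`
  have key : t * (1 + M₀ q + ε * (w ⬝ᵥ x)) ≤ t * (1 + ε * ΦC w) + t * (M₀ q + ε * ΦQ q w) := by linarith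
  have key1 : t * (1 + M₀ q + ε * (w ⬝ᵥ x)) ≤ t * ((1 + ε * ΦC w) + (M₀ q + ε * ΦQ q w)) := by
    have e := mul_add t (1 + ε * ΦC w) (M₀ q + ε * ΦQ q w)
    linarith
  have key2 : 1 + M₀ q + ε * (w ⬝ᵥ x) ≤ (1 + ε * ΦC w) + (M₀ q + ε * ΦQ q w) := le_of_mul_le_mul_left key1 ht
  have key3 : ε * (w ⬝ᵥ x) ≤ ε * ΦC w + ε * ΦQ q w := by linarith
  have key4 : w ⬝ᵥ x ≤ ΦC w + ΦQ q w := by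
    rw [← mul_add] at key3
    exact le_of_mul_le_mul_left key3 hε
  linarith

end Face

end Summit.ValiantsHypothesis.ValiantsHypothesis.Theorems.FifoMatching.PencilCollapse
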